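/-
Copyright (c) 2026. All rights reserved.
Released under Apache 2.0 license as described in the file LICENSE.
Authors: abc-iut cell, seat abc-iut-w5-d053 (gen 4; row «COR37-LOGOBS-GLUE», part (b) of abc-iut-L4-t5's
«COR37-COMPAT-LITERAL» split — saturation of the boundary set of the glued family).
-/
import Literature.AnabelianGeometry.AbsoluteAnabelian.AbsTopIII.BiAnabelianLogGlue
import HarnessLib

/-!
# [AbsTopIII] Cor 3.7 (iii), second clause — the boundary set `GlueE` of the glued family on `𝒟*` is
# SATURATED

S. Mochizuki, *Topics in absolute anabelian geometry III* [MochizukiAbsTopIII2015] (kurims manuscript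
`paper:url-5493eb38cbb7`), Cor 3.7 (iii) p. 88, Def 3.5 (ii) p. 75 (a family of homotopies is indexed by a
SATURATED set of pairs of paths), §0 p. 26 (saturated sets: (a) partial diagonal, (c) transitivity, (d)
pre-composition, (e) post-composition).

Continuation of `BiAnabelianLogGlue.lean` (the normal form «𝒳-pair THEN cell» of the boundary set `GlueE`,
abc-iut-L4-t5's plan `DISCHARGE-PLAN-Cor37-compat.md` §UPDATE): here §0 (a), (c), (d), (e) for `GlueE` —
`StarGlue.isSaturated_glueE` — by the case analysis recorded in its docstring.  PURE COMBINATORICS on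
`Γ⃗_{𝒟*}`; the homotopies `η` on `GlueE` and the closer `logObsCompatCoresStmt_of_iotaOverGal` follow in
`BiAnabelianLogGlueEta.lean` / `BiAnabelianLogGlueFamily.lean`.

HONEST FRAMING: bookkeeping over the cell's typing of refereed pre-IUT material; nothing here bears on
[IUTchIII] Cor. 3.12; no `Prop` fact, no definition, no instance.
-/

set_option autoImplicit false

namespace Literature.AnabelianGeometry.AbsoluteAnabelian.AbsTopIII

open Quiver

universe w

namespace StarGlue

/-! ## `GlueE` is saturated -/

/-- Post-composing a pair into `𝒩` with a path: trivial path — same pair; non-trivial path — it ends at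
`𝔈`, whose class contains every co-terminal pair. [cite: MochizukiAbsTopIII2015, Cor 3.7 (iii) p.88] -/
theorem GlueE.postcomp_space {a : Cor37Vertex} {P R : StarPath.{w} a Cor37Vertex.space} (h : GlueE P R) :
    ∀ {c : Cor37Vertex} (r : StarPath.{w} Cor37Vertex.space c), GlueE (P.comp r) (R.comp r)
  | _, Path.nil => by simpa using h
  | _, Path.cons t e => by
    have hc := eq_galois_of_path_cons (d := Cor37Vertex.space) (by simp [Cor37Vertex.row]) t e
    subst hc
    exact GlueE.gal _ _

/-- **The boundary set `GlueE` is saturated** (§0 p. 26 (a), (c), (d), (e)): reflexive pairs are in;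
pre-composition preserves each class (a prefix that visits `ref` moves a cell pair into the tail classes);
post-composition out of `𝒩` lands in the `𝔈`-class, out of other vertices preserves the tail classes
(re-splitting at a later visit to `ref`); transitivity holds class by class — two cells compose only when
one is reflexive (`StarCell.dichotomy`), tails after the last visit to `ref` are unique (`split_unique`),
and the cell class does not meet the tail classes (`VisitsRef` is constant on each pair).
[cite: MochizukiAbsTopIII2015, Cor 3.7 (iii) p.88] -/
theorem isSaturated_glueE : IsSaturated GlueE.{w} where
  refl_left _ _ _ _ _ := GlueE.rfl _
  refl_right _ _ _ _ _ := GlueE.rfl _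
  precomp := by
    intro a b c P Q h r
    cases h with
    | rfl P => exact GlueE.rfl _
    | gal P R => exact GlueE.gal _ _
    | cell g hg =>
      by_cases hr : VisitsRef r
      · obtain ⟨S⟩ := nonempty_refSplit r hr
        have hg0 : refCount g.left = 0 := ((not_visitsRef_iff _).1 hg).2
        have e1 : r.comp g.left = S.head.comp (g.precomp S.tail).left := by
          rw [StarCell.left_precomp, ← Path.comp_assoc, ← S.eq]
        have e2 : r.comp g.right = S.head.comp (g.precomp S.tail).right := by
          rw [StarCell.right_precomp, ← Path.comp_assoc, ← S.eq]
        rw [e1, e2]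
        exact GlueE.tailCell S.head S.head (g.precomp S.tail)
          (by simp [StarCell.left_precomp, refCount_comp, S.free, hg0])
      · have h1 : ¬ VisitsRef (g.precomp r).left := by
          rw [StarCell.left_precomp, visitsRef_comp_iff]
          rintro (h | h)
          · exact hr h
          · exact hg h
        have h2 := GlueE.cell (g.precomp r) h1
        rwa [StarCell.left_precomp, StarCell.right_precomp] at h2
    | tailEq p q t ht =>
      rw [← Path.comp_assoc, ← Path.comp_assoc]
      exact GlueE.tailEq _ _ t ht
    | tailCell p q g hg =>
      rw [← Path.comp_assoc, ← Path.comp_assoc]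
      exact GlueE.tailCell _ _ g hg
  postcomp := by
    intro a b c P Q h r
    cases h with
    | rfl P => exact GlueE.rfl _
    | gal P R =>
      have hc := eq_galois_of_path_galois r
      subst hc
      exact GlueE.gal _ _
    | cell g hg => exact GlueE.postcomp_space (GlueE.cell g hg) r
    | tailEq p q t ht =>
      by_cases hr : 0 < refCount r
      · obtain ⟨S⟩ := nonempty_refSplit r (Or.inr hr)
        rw [Path.comp_assoc, Path.comp_assoc, S.eq, ← Path.comp_assoc t, ← Path.comp_assoc p,
          ← Path.comp_assoc q]
        exact GlueE.tailEq _ _ S.tail S.free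
      · rw [Path.comp_assoc, Path.comp_assoc]
        exact GlueE.tailEq p q (t.comp r) (by rw [refCount_comp]; omega)
    | tailCell p q g hg => exact GlueE.postcomp_space (GlueE.tailCell p q g hg) r
  trans := by
    intro a b P Q R h₁ h₂
    by_cases hb : b = Cor37Vertex.galois
    · subst hb; exact GlueE.gal _ _
    cases h₁ with
    | rfl P => exact h₂
    | gal P Q => exact absurd rfl hb
    | cell g hg =>
      have hgr : ¬ VisitsRef g.right := (StarCell.visitsRef_left_iff g).not.1 hg
      generalize hQ : g.right = Q' at h₂
      cases h₂ with
      | rfl _ => rw [← hQ]; exact GlueE.cell g hg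
      | cell g' hg' =>
        rcases StarCell.dichotomy hQ with h | h
        · rw [h, hQ]; exact GlueE.cell g' hg'
        · rw [h, ← hQ]; exact GlueE.cell g hg
      | tailEq p q t ht =>
        rw [hQ] at hgr; exact absurd (visitsRef_comp_ref p t) hgr
      | tailCell p q g' hg' =>
        rw [hQ] at hgr; exact absurd (visitsRef_comp_ref p g'.left) hgr
    | tailEq p q t ht =>
      generalize hQ : q.comp t = Q' at h₂
      cases h₂ with
      | rfl _ => rw [← hQ]; exact GlueE.tailEq p q t ht
      | gal _ _ => exact absurd rfl hb
      | cell g' hg' =>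
        rw [← hQ] at hg'; exact absurd (visitsRef_comp_ref q t) hg'
      | tailEq p' q' t' ht' =>
        obtain ⟨-, htt⟩ := split_unique q p' t t' hQ ht ht'
        rw [← htt]; exact GlueE.tailEq p q' t ht
      | tailCell p' q' g' hg' =>
        obtain ⟨-, htt⟩ := split_unique q p' t g'.left hQ ht hg'
        rw [htt]; exact GlueE.tailCell p q' g' hg'
    | tailCell p q g hg =>
      have hgr : refCount g.right = 0 := by rw [← StarCell.refCount_left_eq_right]; exact hg
      generalize hQ : q.comp g.right = Q' at h₂
      cases h₂ with
      | rfl _ => rw [← hQ]; exact GlueE.tailCell p q g hg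
      | cell g' hg' =>
        rw [← hQ] at hg'; exact absurd (visitsRef_comp_ref q g.right) hg'
      | tailEq p' q' t' ht' =>
        obtain ⟨-, htt⟩ := split_unique q p' g.right t' hQ hgr ht'
        rw [← htt]; exact GlueE.tailCell p q' g hg
      | tailCell p' q' g' hg' =>
        obtain ⟨-, htt⟩ := split_unique q p' g.right g'.left hQ hgr hg'
        rcases StarCell.dichotomy htt with h | h
        · rw [h, htt]; exact GlueE.tailCell p q' g' hg'
        · rw [h, ← htt]; exact GlueE.tailCell p q' g hg

end StarGlue

end Literature.AnabelianGeometry.AbsoluteAnabelian.AbsTopIII
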